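import Summits.Parity.BatemanHorn.Theorems.AlmostPrimeZerosLinearCappedRepulsionRieszDiffParams
import Summits.Parity.BatemanHorn.Theorems.AlmostPrimeZerosLinearCappedRepulsionRieszDiffNegligible
import HarnessLib

/-!
# The one-sided Selberg–Delange bound for a difference of Riesz means (the stub)
(crux stmt-Parity-11327, line `jensen-stieltjes-majorant`, stub `stub_rieszDiffEngine`)

Everything here is PROVED (theorems only).  Part of the one-sided Selberg–Delange bound for the
DIFFERENCE of two Riesz means `A₁(x+h) − A₁(x)` of a Dirichlet series `Σ a(n) n^{-s} = ζ(s)^z G(s)`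
(data `SelbergDelange.RieszData R (4/5) B z a G` of the tree's contour engine
`Literature/NumberTheory/LFunctions/SelbergDelangeRieszExpansion.lean`, Montgomery–Vaughan §7.4,
proof of Theorem 7.17): `‖A₁(x+h) − A₁(x)‖ ≤ h·x·(log x)^{Re z−1}·B·e^{c(1+R)^{3/2}}` for
`x e^{−(log log x)³} ≤ h ≤ x`, `1 ≤ R ≤ log log x` — the SIZE of the main term with every constant
explicit in `R`, no main term, no Hankel evaluation, no Taylor expansion at the branch point.

This file: the registered stub `stub_rieszDiffEngine` — choice of the parameters
(`T = exp(3(log log x)³)`, `b = leftAbscissa T`), verification of the admissibility conditions for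
`x ≥ X₀ = exp(exp ℓ₀)` (`RieszDiff.eventually_master`), and the assembly of
`RieszDiff.norm_rieszMean_diff_le_of_params` with the error-term bounds of parts III–IV.

## References

* [MontgomeryVaughan2007] H. L. Montgomery, R. C. Vaughan, *Multiplicative Number Theory I*,
  CUP 2007, §7.4, proof of Theorem 7.17 (pp. 177–178).
* [Tenenbaum2015] G. Tenenbaum, *Introduction to analytic and probabilistic number theory*, 3rd
  ed., AMS GSM 163, II.5 §§5.3–5.4.
-/

noncomputable section

open Complex Set MeasureTheory Filter Topology intervalIntegral Metric
open scoped Real Nat Interval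
open Literature.Analysis.Complex Literature.Analysis.Complex.Keyhole
open Literature.NumberTheory.LFunctions Literature.NumberTheory.LFunctions.SelbergDelange

namespace Summit.Parity.BatemanHorn.Cruxes.LinearCappedRepulsion.JensenStieltjesMajorant

open RieszDiff in
/-- **Stub 1b (analytic): the one-sided Selberg–Delange bound for a difference of Riesz means.**
There are `X₀` and `c ≥ 0` such that for all data `SelbergDelange.RieszData R (4/5) B z a G`
with `R ≥ 1`, all real `x ≥ X₀` with `R ≤ log log x`, and all `h` with `x·e^{−(log log x)³} ≤ h ≤ x`:
`‖A₁(x+h) − A₁(x)‖ ≤ h · x · (log x)^{Re z − 1} · B · exp(c (1+R)^{3/2})`,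
`A₁(y) = Σ_{1≤n≤y} a(n)(y − n)`.  Proof: `norm_rieszMean_diff_le_of_params` with `T = exp(3ℓ³)`
(`ℓ = log log x`), the four non-keyhole terms being `≤ x² B e^{−ℓ³−(R+1)ℓ} ≤ h x (log x)^{Re z−1} B`
(`tails_le`, `hor_le`, `far_le`, `near_le`, `unit_le`) once `ℓ` is large (`eventually_master`:
`ℓ ≥ C₀ + 3`, `e^ℓ ≥ K ℓ⁶` with `K = 2(C₀ + M₀ + log(1/c̄) + 20)/c̄`, `2c̄/(3ℓ³) + e^{−ℓ} ≤ ρ/4`),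
and the keyhole term being `26 e^{(π+M₀)R} keyholeConst(⌈R⌉) · h x (log x)^{Re z−1} B` with
`keyholeConst(⌈R⌉) ≤ 28 e^{3(1+R)^{3/2}}`; `c = 12 + M₀`.
[cite: MontgomeryVaughan2007, §7.4 pp. 177–178] -/
theorem stub_rieszDiffEngine :
    ∃ X₀ : ℝ, ∃ c : ℝ, 0 ≤ c ∧ ∀ (R B : ℝ) (z : ℂ) (a : ℕ → ℂ) (G : ℂ → ℂ), 1 ≤ R →
      SelbergDelange.RieszData R (4 / 5) B z a G →
      ∀ x h : ℝ, X₀ ≤ x → R ≤ Real.log (Real.log x) →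
        x * Real.exp (-(Real.log (Real.log x) ^ 3)) ≤ h → h ≤ x →
        ‖(∑ n ∈ Finset.Ioc 0 ⌊x + h⌋₊, a n * (((x + h : ℝ) : ℂ) - n)) -
            ∑ n ∈ Finset.Ioc 0 ⌊x⌋₊, a n * ((x : ℂ) - n)‖ ≤
          h * x * Real.log x ^ (z.re - 1) * B * Real.exp (c * (1 + R) ^ (3 / 2 : ℝ)) := by
  -- absolute constants
  obtain ⟨C₀, hC₀0, hC₀⟩ := SatheSelberg.exists_norm_logZeta_sub_log_le
  obtain ⟨M₀, hM₀0, hM₀⟩ := SatheSelberg.exists_norm_logZeta₁_le_near_one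
  have hcbar := zfrConst_pos
  have hcbar1 := zfrConst_le
  set Λ : ℝ := Real.log (1 / zfrConst) with hΛdef
  have hΛ0 : 0 ≤ Λ := Real.log_nonneg (by rw [le_div_iff₀ hcbar]; linarith)
  obtain ⟨hρ, -, -⟩ := rho_pos (by norm_num : (4 / 5 : ℝ) < 1)
  set ρ : ℝ := rho (4 / 5) with hρdef
  set K : ℝ := 2 * (C₀ + M₀ + Λ + 20) / zfrConst with hKdef
  obtain ⟨ℓ₀, hℓ₀⟩ := Filter.eventually_atTop.1 (eventually_master (C₀ + 3) K hρ)
  refine ⟨Real.exp (Real.exp ℓ₀), 12 + M₀, by positivity, ?_⟩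
  intro R B z a G hR1 hData x h hxX hRℓx hh1 hh2
  -- the scales
  have hX1 : 1 < Real.exp (Real.exp ℓ₀) := by
    rw [← Real.exp_zero]; exact Real.exp_lt_exp.2 (Real.exp_pos ℓ₀)
  have hx1 : 1 < x := hX1.trans_le hxX
  have hx0 : 0 < x := by linarith
  set L : ℝ := Real.log x with hLdef
  set ℓ : ℝ := Real.log L with hℓdef
  have hL0 : 0 < L := Real.log_pos hx1
  have hℓ₀ℓ : ℓ₀ ≤ ℓ := by
    have h1 : Real.exp ℓ₀ ≤ L := by rw [hLdef, Real.le_log_iff_exp_le hx0]; exact hxX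
    rw [hℓdef, Real.le_log_iff_exp_le hL0]; exact h1
  obtain ⟨hℓ2, hℓC, hKℓ, hρ4⟩ := hℓ₀ ℓ hℓ₀ℓ
  obtain ⟨-, hxL, -, hLℓ, hL7, hx2, -⟩ := scales hx1 hLdef hℓdef hℓ2
  have hℓ0 : 0 < ℓ := by linarith
  have hℓ3 : 8 ≤ ℓ ^ 3 := by
    have := pow_le_pow_left₀ (by norm_num : (0:ℝ) ≤ 2) hℓ2 3; norm_num at this; exact this
  have hR0 : 0 ≤ R := by linarith
  have hRℓ : R ≤ ℓ := hRℓx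
  -- the parameters `T`, `b = leftAbscissa T`
  set T : ℝ := Real.exp (3 * ℓ ^ 3) with hTdef
  obtain ⟨hT3, hlogT1, hlogT2⟩ := height_bounds hℓ2 hTdef
  have hT1 : 1 ≤ T := by linarith
  set b : ℝ := leftAbscissa T with hbdef
  obtain ⟨h1b, h1bpos⟩ := one_sub_leftAbscissa (by linarith : (0:ℝ) ≤ T)
  have h1bpos' : 0 < 1 - b := by rw [h1b]; exact h1bpos
  have hb1 : b < 1 := by linarith
  have hlogT0 : 0 < Real.log (T + 3) := by linarith
  -- `1 − b ≤ 2c̄/(3ℓ³) ≤ 1/1200`, so `b > 4/5`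
  have h1b_le : 1 - b ≤ 2 * zfrConst / (3 * ℓ ^ 3) := by
    rw [h1b]; exact div_le_div_of_nonneg_left (by linarith) (by positivity) hlogT1
  have hσ₁b : (4 / 5 : ℝ) < b := by
    have : 2 * zfrConst / (3 * ℓ ^ 3) ≤ 2 * (1 / 100) / (3 * 8) :=
      div_le_div₀ (by norm_num) (by linarith) (by norm_num) (by linarith)
    linarith [h1b_le]
  -- `1 − b ≥ c̄/(2ℓ³)`
  have h1b_ge : zfrConst / (2 * ℓ ^ 3) ≤ 1 - b := by
    rw [h1b]
    calc zfrConst / (2 * ℓ ^ 3) = 2 * zfrConst / (4 * ℓ ^ 3) := by field_simp; ring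
      _ ≤ 2 * zfrConst / Real.log (T + 3) :=
          div_le_div_of_nonneg_left (by linarith) hlogT0 (by linarith)
  -- `β = L(1 − b) ≥ (C₀ + M₀ + Λ + 20) ℓ³`
  have hβ : (C₀ + M₀ + Λ + 20) * ℓ ^ 3 ≤ L * (1 - b) := by
    have hL' : K * ℓ ^ 6 ≤ L := by rw [hLℓ]; exact hKℓ
    calc (C₀ + M₀ + Λ + 20) * ℓ ^ 3 = (K * ℓ ^ 6) * (zfrConst / (2 * ℓ ^ 3)) := by
          rw [hKdef]; field_simp
      _ ≤ L * (1 - b) := mul_le_mul hL' h1b_ge (by positivity) hL0.le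
  have hℓ30 : 0 ≤ ℓ ^ 3 := by positivity
  have hβC : (C₀ + 20) * ℓ ^ 3 ≤ L * (1 - b) :=
    le_trans (mul_le_mul_of_nonneg_right (by linarith) hℓ30) hβ
  have hβM : (M₀ + Λ + 20) * ℓ ^ 3 ≤ L * (1 - b) :=
    le_trans (mul_le_mul_of_nonneg_right (by linarith) hℓ30) hβ
  have hβ1 : 1 ≤ L * (1 - b) := by
    have : (1 : ℝ) ≤ (C₀ + 20) * ℓ ^ 3 := by nlinarith
    exact this.trans hβC
  -- `(β + 1)/L ≤ ρ/4`
  have hfit : (L * (1 - b) + 1) / L ≤ ρ / 4 := by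
    have e : (L * (1 - b) + 1) / L = (1 - b) + 1 / L := by field_simp
    have h1L : 1 / L = Real.exp (-ℓ) := by rw [hLℓ, Real.exp_neg]; field_simp
    rw [e, h1L]; linarith [h1b_le, hρ4]
  -- `log(1/(1−b)) ≤ 1 + 3ℓ + Λ`
  have hlog1b : Real.log (1 / (1 - b)) ≤ 1 + 3 * ℓ + Λ := by
    have hup : 1 / (1 - b) ≤ 2 * ℓ ^ 3 / zfrConst := by
      rw [div_le_div_iff₀ h1bpos' hcbar]
      have := (div_le_iff₀ (by positivity : (0:ℝ) < 2 * ℓ ^ 3)).1 h1b_ge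
      linarith
    calc Real.log (1 / (1 - b)) ≤ Real.log (2 * ℓ ^ 3 / zfrConst) :=
          Real.log_le_log (by positivity) hup
      _ = Real.log 2 + 3 * Real.log ℓ + Λ := by
          rw [Real.log_div (by positivity) hcbar.ne', Real.log_mul (by norm_num) (by positivity),
            Real.log_pow, hΛdef, one_div, Real.log_inv]
          push_cast; ring
      _ ≤ 1 + 3 * ℓ + Λ := by
          have := numerics.2.2
          have hℓlog : Real.log ℓ ≤ ℓ := (Real.log_le_sub_one_of_pos hℓ0).trans (by linarith)
          linarith
  -- the explicit constants far / near
  have hCf := norm_zetaPow_le_far_explicit hC₀ hR0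
  have hCn := norm_exp_mul_logZeta₁_le_explicit hM₀ hR0
  -- the fixed-parameter estimate at `y = x + h`
  have hh0 : 0 < h := lt_of_lt_of_le (by positivity) hh1
  have hxy : x ≤ x + h := by linarith
  have hy2 : x + h ≤ 2 * x := by linarith
  have hmain := norm_rieszMean_diff_le_of_params hData (by norm_num : (4 / 5 : ℝ) < 1) hCf hCn hx1
    hxy hy2 (by linarith : 1 ≤ L) hT1 hσ₁b hβ1 hfit
  rw [← hLdef, ← hbdef] at hmain
  refine hmain.trans ?_
  -- the four negligible terms and the unit
  have hB0 : 0 ≤ B := (norm_nonneg _).trans (hData.norm_G_le 2 (by norm_num))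
  have hb0 : 0 ≤ b := by linarith
  have h1L0 : (0:ℝ) ≤ 1 / L := by positivity
  have hbaa : b ≤ 1 + 1 / L := by linarith
  have ht := tails_le hx1 hLdef hℓdef hℓ2 hRℓ hB0 hTdef
  have hho := hor_le hx1 hLdef hℓdef hℓ2 hℓC hC₀0 hR0 hRℓ hB0 hTdef hb0 hbaa
  have hfa := far_le hx1 hLdef hℓdef hℓ2 hC₀0 hR0 hRℓ hB0 hTdef hb1.le hβC
  have hne := near_le hx1 hLdef hℓdef hℓ2 hM₀0 hΛ0 hR0 hRℓ hB0 hb0 hb1 hlog1b hβM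
  have hre : -R ≤ z.re := by
    linarith [neg_abs_le z.re, (abs_re_le_norm z).trans hData.norm_le]
  have hU := unit_le hx1 hLdef hℓdef hℓ2 hB0 hre hh1
  obtain ⟨U, hUdef⟩ : ∃ U : ℝ, U = h * x * L ^ (z.re - 1) * B := ⟨_, rfl⟩
  have hU' : x ^ 2 * B * Real.exp (-ℓ ^ 3 - (R + 1) * ℓ) ≤ U := by rw [hUdef]; exact hU
  have hU0 : 0 ≤ U := by rw [hUdef]; exact mul_nonneg (by positivity) hB0
  -- the keyhole term
  obtain ⟨P, hPdef⟩ : ∃ P : ℝ, P = (1 + R) ^ (3 / 2 : ℝ) := ⟨_, rfl⟩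
  have hkc : keyholeConst ⌈R⌉₊ ≤ 28 * Real.exp (3 * P) := by
    rw [hPdef]; exact keyholeConst_ceil_le hR0
  have hRP : 1 + R ≤ P := by
    rw [hPdef]
    calc 1 + R = (1 + R) ^ (1 : ℝ) := (Real.rpow_one _).symm
      _ ≤ (1 + R) ^ (3 / 2 : ℝ) := Real.rpow_le_rpow_of_exponent_le (by linarith) (by norm_num)
  have hP1 : 1 ≤ P := by linarith
  obtain ⟨E, hEdef⟩ : ∃ E : ℝ, E = Real.exp (π * R) * Real.exp (R * M₀) := ⟨_, rfl⟩
  have hE : E ≤ Real.exp ((4 + M₀) * P) := by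
    rw [hEdef, ← Real.exp_add, Real.exp_le_exp]
    have hπ4 : π ≤ 4 := Real.pi_lt_four.le
    have h1 : π * R ≤ 4 * P := mul_le_mul hπ4 (show R ≤ P by linarith) hR0 (by norm_num)
    have h2 : R * M₀ ≤ P * M₀ := mul_le_mul_of_nonneg_right (show R ≤ P by linarith) hM₀0
    linarith
  have hE0 : 0 ≤ E := by rw [hEdef]; positivity
  have hkc0 : 0 ≤ keyholeConst ⌈R⌉₊ := (keyholeConst_pos _).le
  have hkey : 13 * Real.exp (π * R) * (Real.exp (R * M₀) * B * 2) * keyholeConst ⌈R⌉₊ *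
      (x + h - x) * x * L ^ (z.re - 1) = 26 * E * keyholeConst ⌈R⌉₊ * U := by
    rw [hUdef, hEdef]; ring
  -- assembling: `(2π)⁻¹ (4U + 26 E kC U) ≤ U (1 + 5 E kC) ≤ U e^{(12+M₀)P}`
  have hπ : (2 * π)⁻¹ ≤ 1 / 6 := by
    rw [inv_eq_one_div]
    exact div_le_div_of_nonneg_left (by norm_num) (by norm_num) (by linarith [Real.pi_gt_three])
  have hS : 4 * ((2 * x) ^ (1 + (1 + 1 / L)) * (B / (1 / L) ^ R) / T) +
      4 * ((1 + 1 / L - b) * ((2 * x) ^ (1 + (1 + 1 / L)) *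
        (Real.exp (R * C₀) * Real.log (T + 3) ^ R) * B / T ^ 2)) +
      4 * (4 * π * ((2 * x) ^ (1 + b) * (Real.exp (R * C₀) * Real.log (T + 3) ^ R) * B)) +
      4 * (4 * ((2 * x) ^ (1 + b) * Real.exp (R * M₀) * Real.exp (π * R) * B *
        ((1 - b) ^ (-R) + 2 ^ R))) +
      13 * Real.exp (π * R) * (Real.exp (R * M₀) * B * 2) * keyholeConst ⌈R⌉₊ *
        (x + h - x) * x * L ^ (z.re - 1) ≤ 4 * U + 26 * E * keyholeConst ⌈R⌉₊ * U := by
    rw [hkey]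
    linarith only [ht.trans hU', hho.trans hU', hfa.trans hU', hne.trans hU']
  have hfinal : (1 : ℝ) + 5 * E * keyholeConst ⌈R⌉₊ ≤ Real.exp ((12 + M₀) * P) :=
    final_constant_le hM₀0 hP1 hE hkc hkc0
  calc (2 * π)⁻¹ * (4 * ((2 * x) ^ (1 + (1 + 1 / L)) * (B / (1 / L) ^ R) / T) +
        4 * ((1 + 1 / L - b) * ((2 * x) ^ (1 + (1 + 1 / L)) *
          (Real.exp (R * C₀) * Real.log (T + 3) ^ R) * B / T ^ 2)) +
        4 * (4 * π * ((2 * x) ^ (1 + b) * (Real.exp (R * C₀) * Real.log (T + 3) ^ R) * B)) +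
        4 * (4 * ((2 * x) ^ (1 + b) * Real.exp (R * M₀) * Real.exp (π * R) * B *
          ((1 - b) ^ (-R) + 2 ^ R))) +
        13 * Real.exp (π * R) * (Real.exp (R * M₀) * B * 2) * keyholeConst ⌈R⌉₊ *
          (x + h - x) * x * L ^ (z.re - 1))
      ≤ (2 * π)⁻¹ * (4 * U + 26 * E * keyholeConst ⌈R⌉₊ * U) :=
        mul_le_mul_of_nonneg_left hS (by positivity)
    _ ≤ (1 / 6) * (4 * U + 26 * E * keyholeConst ⌈R⌉₊ * U) :=
        mul_le_mul_of_nonneg_right hπ (by positivity)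
    _ ≤ U * (1 + 5 * E * keyholeConst ⌈R⌉₊) := by
        have h0 : 0 ≤ E * keyholeConst ⌈R⌉₊ * U := by positivity
        nlinarith only [h0, hU0]
    _ ≤ U * Real.exp ((12 + M₀) * P) := mul_le_mul_of_nonneg_left hfinal hU0
    _ = h * x * L ^ (z.re - 1) * B * Real.exp ((12 + M₀) * (1 + R) ^ (3 / 2 : ℝ)) := by
        rw [hUdef, hPdef]

end Summit.Parity.BatemanHorn.Cruxes.LinearCappedRepulsion.JensenStieltjesMajorant
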